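import Summits.Ventures.PercRepro.OrbitKAllMarked

/-!
# PercRepro — injective markings suffice for ORBIT-k, by sure pendant edges (typer-2, gen 7)

A constant-free companion of `OrbitKDedup`: any marking `m : Fin k → V` of `G` becomes an INJECTIVE marking of the
graph `G.pendantAt m` = `G` with a new pendant vertex `w_i` and a new edge `e_i = (m i, w_i)` for EVERY index `i`
(vertices `V ⊕ Fin k`, edges `E ⊕ Fin k`), marked by `w_i`. With the pendant edges in the SURE part of the interval
(`I′ = withPendants I`, `D′ = withoutPendants D`) every `A ≤ D′` is `withoutPendants A` for an `A ≤ D`, the open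
clusters of the marks are unchanged (`conn_pendantAt_inr_iff`), so every class count, `N(A)`, `c_l` and `a_ij`, is
the same — and the number of marks `k` is the same, so the constants are untouched. Hence

* **`C023_of_C023Inj'`** and **`C023Skip_of_C023SkipInj`** / **`C023Skip_iff_C023SkipInj`**: the typed rows on
  arbitrary markings ARE their injective (census) readings — for `C023Skip` this is the half `OrbitKDedup` could
  not give (it needed `kappaAff` antitone in `k` for every `k`).
-/

namespace PercRepro

open Finset

namespace MultiGraph

variable {V E : Type*} (G : MultiGraph V E)

/-- `G` with a pendant edge `e_i = (m i, w_i)` attached at every mark `i`: vertices `V ⊕ Fin k`, edges `E ⊕ Fin k`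
(`inl e` = the old edge `e`, `inr i` = the pendant edge at the mark `i`). -/
def pendantAt {k : ℕ} (m : Fin k → V) : MultiGraph (V ⊕ Fin k) (E ⊕ Fin k) :=
  ⟨Sum.elim (fun e => Sum.inl (G.fst e)) (fun i => Sum.inl (m i)),
    Sum.elim (fun e => Sum.inl (G.snd e)) fun i => Sum.inr i⟩

/-- A configuration of `G`, with every pendant edge OPEN. -/
def withPendants (ω : Config E) (k : ℕ) : Config (E ⊕ Fin k) := Sum.elim ω fun _ => true

/-- A configuration of `G`, with every pendant edge CLOSED. -/
def withoutPendants (ω : Config E) (k : ℕ) : Config (E ⊕ Fin k) := Sum.elim ω fun _ => false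

/-- The projection of the pendant graph's vertices back to `V` (`w_i ↦ m i`). -/
def pendProj {k : ℕ} (m : Fin k → V) : V ⊕ Fin k → V := Sum.elim id m

omit G in
/-- `withPendants` restricted to the old edges. -/
theorem withPendants_inl (ω : Config E) (k : ℕ) (e : E) : withPendants ω k (Sum.inl e) = ω e := rfl

omit G in
/-- Every pendant edge is open in `withPendants`. -/
theorem withPendants_inr (ω : Config E) (k : ℕ) (i : Fin k) : withPendants ω k (Sum.inr i) = true := rfl

/-- **Connectivity in the pendant graph projects to connectivity in `G`** (for any configuration `ω′` of the
pendant graph, read on the old edges): a step through a pendant edge does not move the projection. -/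
theorem conn_pendantAt_proj {k : ℕ} (m : Fin k → V) (ω' : Config (E ⊕ Fin k)) {x y : V ⊕ Fin k}
    (h : (G.pendantAt m).Conn ω' x y) : G.Conn (fun e => ω' (Sum.inl e)) (pendProj m x) (pendProj m y) := by
  refine Conn.induction (motive := fun y => G.Conn (fun e => ω' (Sum.inl e)) (pendProj m x) (pendProj m y))
    (Conn.refl G _ _) ?_ h
  intro a b _ hab ih
  obtain ⟨e, he, hend⟩ := hab
  rcases e with e | i
  · have hadj : G.OpenAdj (fun e => ω' (Sum.inl e)) (pendProj m a) (pendProj m b) := by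
      refine ⟨e, he, ?_⟩
      rcases hend with ⟨h1, h2⟩ | ⟨h1, h2⟩
      · left
        simp only [pendantAt, Sum.elim_inl] at h1 h2
        rw [← h1, ← h2]
        exact ⟨rfl, rfl⟩
      · right
        simp only [pendantAt, Sum.elim_inl] at h1 h2
        rw [← h1, ← h2]
        exact ⟨rfl, rfl⟩
    exact ih.trans (Conn.of_openAdj hadj)
  · rcases hend with ⟨h1, h2⟩ | ⟨h1, h2⟩
    · simp only [pendantAt, Sum.elim_inr] at h1 h2
      subst h1
      subst h2
      exact ih
    · simp only [pendantAt, Sum.elim_inr] at h1 h2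
      subst h1
      subst h2
      exact ih

/-- Connectivity in `G` lifts to the old vertices of the pendant graph (pendant edges open or not). -/
theorem conn_pendantAt_inl {k : ℕ} (m : Fin k → V) (ω : Config E) (b : Fin k → Bool) {u v : V}
    (h : G.Conn ω u v) : (G.pendantAt m).Conn (Sum.elim ω b) (Sum.inl u) (Sum.inl v) := by
  refine Conn.induction (motive := fun v => (G.pendantAt m).Conn (Sum.elim ω b) (Sum.inl u) (Sum.inl v))
    (Conn.refl (G.pendantAt m) _ _) ?_ h
  intro a c _ hac ih
  obtain ⟨e, he, hend⟩ := hac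
  refine ih.trans (Conn.of_openAdj ⟨Sum.inl e, he, ?_⟩)
  rcases hend with ⟨h1, h2⟩ | ⟨h1, h2⟩
  · exact Or.inl ⟨congrArg Sum.inl h1, congrArg Sum.inl h2⟩
  · exact Or.inr ⟨congrArg Sum.inl h1, congrArg Sum.inl h2⟩

/-- The pendant vertex `w_i` is joined to its mark `m i` when the pendant edges are open. -/
theorem conn_pendantAt_inr_inl {k : ℕ} (m : Fin k → V) (ω : Config E) (i : Fin k) :
    (G.pendantAt m).Conn (withPendants ω k) (Sum.inr i) (Sum.inl (m i)) :=
  Conn.symm (Conn.of_openAdj ⟨Sum.inr i, rfl, Or.inl ⟨rfl, rfl⟩⟩)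

/-- **The pendant marks are connected iff the original marks are** (pendant edges open). -/
theorem conn_pendantAt_inr_iff {k : ℕ} (m : Fin k → V) (ω : Config E) (i j : Fin k) :
    (G.pendantAt m).Conn (withPendants ω k) (Sum.inr i) (Sum.inr j) ↔ G.Conn ω (m i) (m j) := by
  constructor
  · intro h
    exact G.conn_pendantAt_proj m (withPendants ω k) h
  · intro h
    exact ((G.conn_pendantAt_inr_inl m ω i).trans (G.conn_pendantAt_inl m ω (fun _ => true) h)).trans
      (Conn.symm (G.conn_pendantAt_inr_inl m ω j))

variable [DecidableEq V] [Fintype V] [Fintype E] [DecidableEq E]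

omit [DecidableEq E] in
/-- **The mark classes are unchanged by the pendant construction.** -/
theorem markClasses_pendantAt {k : ℕ} (m : Fin k → V) (ω : Config E) :
    (G.pendantAt m).markClasses (withPendants ω k) (fun i => Sum.inr i) = G.markClasses ω m := by
  unfold markClasses
  congr 1
  refine Finset.image_congr fun i _ => ?_
  exact Finset.filter_congr fun j _ => G.conn_pendantAt_inr_iff m ω i j

omit [DecidableEq V] [Fintype V] [Fintype E] [DecidableEq E] in
/-- `I′ ⊔ withoutPendants A = withPendants (I ⊔ A)`. -/
theorem withPendants_sup_withoutPendants (I A : Config E) (k : ℕ) :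
    withPendants I k ⊔ withoutPendants A k = withPendants (I ⊔ A) k := by
  funext e
  rcases e with e | i <;> simp [withPendants, withoutPendants]

omit [DecidableEq V] [Fintype V] [Fintype E] [DecidableEq E] in
/-- `D′ ⊓ (withoutPendants A)ᶜ = withoutPendants (D ⊓ Aᶜ)`. -/
theorem withoutPendants_inf_compl (D A : Config E) (k : ℕ) :
    withoutPendants D k ⊓ (withoutPendants A k)ᶜ = withoutPendants (D ⊓ Aᶜ) k := by
  funext e
  rcases e with e | i <;> simp [withoutPendants]

omit [DecidableEq V] [Fintype V] [Fintype E] [DecidableEq E] in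
/-- `withoutPendants A ≤ withoutPendants D ↔ A ≤ D`. -/
theorem withoutPendants_le_iff (A D : Config E) (k : ℕ) :
    withoutPendants A k ≤ withoutPendants D k ↔ A ≤ D := by
  constructor
  · intro h e
    exact h (Sum.inl e)
  · intro h e
    rcases e with e | i
    · exact h e
    · exact le_rfl

omit [DecidableEq V] [Fintype V] [Fintype E] [DecidableEq E] in
/-- A configuration below `withoutPendants D` is `withoutPendants` of its restriction. -/
theorem eq_withoutPendants_of_le {k : ℕ} {A' : Config (E ⊕ Fin k)} {D : Config E} (h : A' ≤ withoutPendants D k) :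
    A' = withoutPendants (fun e => A' (Sum.inl e)) k := by
  funext e
  rcases e with e | i
  · rfl
  · have := h (Sum.inr i)
    simp only [withoutPendants, Sum.elim_inr] at this ⊢
    exact Bool.eq_false_iff.mpr fun hc => absurd (Bool.le_iff_imp.mp this hc) Bool.false_ne_true

omit [DecidableEq V] [Fintype V] [Fintype E] [DecidableEq E] in
/-- `withPendants I ⊓ withoutPendants D = ⊥` when `I ⊓ D = ⊥`. -/
theorem withPendants_inf_withoutPendants {I D : Config E} (h : I ⊓ D = ⊥) (k : ℕ) :
    withPendants I k ⊓ withoutPendants D k = ⊥ := by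
  funext e
  rcases e with e | i
  · have := congrFun h e
    simpa [withPendants, withoutPendants] using this
  · simp [withPendants, withoutPendants]

/-- The interval count is unchanged by the pendant construction. -/
theorem intervalCount_pendantAt {k : ℕ} (m : Fin k → V) (I D : Config E) (l : ℕ) :
    (G.pendantAt m).intervalCount (fun i => Sum.inr i) (withPendants I k) (withoutPendants D k) l =
      G.intervalCount m I D l := by
  unfold intervalCount
  refine Finset.card_bij' (fun A' _ => fun e => A' (Sum.inl e)) (fun A _ => withoutPendants A k) ?_ ?_ ?_ ?_
  · intro A' hA'
    rw [Finset.mem_filter] at hA' ⊢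
    obtain ⟨-, h1, h2⟩ := hA'
    refine ⟨Finset.mem_univ _, ?_, ?_⟩
    · intro e
      exact h1 (Sum.inl e)
    · rw [eq_withoutPendants_of_le h1, withPendants_sup_withoutPendants, G.markClasses_pendantAt] at h2
      exact h2
  · intro A hA
    rw [Finset.mem_filter] at hA ⊢
    obtain ⟨-, h1, h2⟩ := hA
    refine ⟨Finset.mem_univ _, (withoutPendants_le_iff A D k).mpr h1, ?_⟩
    rw [withPendants_sup_withoutPendants, G.markClasses_pendantAt]
    exact h2
  · intro A' hA'
    rw [Finset.mem_filter] at hA'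
    exact (eq_withoutPendants_of_le hA'.2.1).symm
  · intro A _
    rfl

/-- The antipodal count is unchanged by the pendant construction. -/
theorem antipodalCount_pendantAt {k : ℕ} (m : Fin k → V) (I D : Config E) (i j : ℕ) :
    (G.pendantAt m).antipodalCount (fun i => Sum.inr i) (withPendants I k) (withoutPendants D k) i j =
      G.antipodalCount m I D i j := by
  unfold antipodalCount
  refine Finset.card_bij' (fun A' _ => fun e => A' (Sum.inl e)) (fun A _ => withoutPendants A k) ?_ ?_ ?_ ?_
  · intro A' hA'
    rw [Finset.mem_filter] at hA' ⊢
    obtain ⟨-, h1, h2, h3⟩ := hA'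
    refine ⟨Finset.mem_univ _, fun e => h1 (Sum.inl e), ?_, ?_⟩
    · rw [eq_withoutPendants_of_le h1, withPendants_sup_withoutPendants, G.markClasses_pendantAt] at h2
      exact h2
    · rw [eq_withoutPendants_of_le h1, withoutPendants_inf_compl, withPendants_sup_withoutPendants,
        G.markClasses_pendantAt] at h3
      exact h3
  · intro A hA
    rw [Finset.mem_filter] at hA ⊢
    obtain ⟨-, h1, h2, h3⟩ := hA
    refine ⟨Finset.mem_univ _, (withoutPendants_le_iff A D k).mpr h1, ?_, ?_⟩
    · rw [withPendants_sup_withoutPendants, G.markClasses_pendantAt]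
      exact h2
    · rw [withoutPendants_inf_compl, withPendants_sup_withoutPendants, G.markClasses_pendantAt]
      exact h3
  · intro A' hA'
    rw [Finset.mem_filter] at hA'
    exact (eq_withoutPendants_of_le hA'.2.1).symm
  · intro A _
    rfl

/-- `OrbitK` is unchanged by the pendant construction (same `k`, same counts). -/
theorem orbitK_pendantAt {k : ℕ} (m : Fin k → V) (I D : Config E) (i j : ℕ) :
    (G.pendantAt m).OrbitK (fun i => Sum.inr i) (withPendants I k) (withoutPendants D k) i j ↔
      G.OrbitK m I D i j := by
  unfold OrbitK
  rw [G.antipodalCount_pendantAt]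
  simp only [G.intervalCount_pendantAt]

/-- `OrbitKAff` is unchanged by the pendant construction. -/
theorem orbitKAff_pendantAt {k : ℕ} (m : Fin k → V) (I D : Config E) (i j : ℕ) :
    (G.pendantAt m).OrbitKAff (fun i => Sum.inr i) (withPendants I k) (withoutPendants D k) i j ↔
      G.OrbitKAff m I D i j := by
  unfold OrbitKAff
  rw [G.antipodalCount_pendantAt]
  simp only [G.intervalCount_pendantAt]

end MultiGraph

/-- **The injective row gives the row on arbitrary markings, with no constant comparison**: mark the pendant
vertices instead. -/
theorem C023_of_C023Inj' (h : C023Inj) : C023 := by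
  intro V E _ _ _ _ G k hk m I D hID i j hi hij hj
  rw [← G.orbitK_pendantAt m I D i j]
  exact h (G.pendantAt m) k hk (fun i => Sum.inr i) Sum.inr_injective _ _
    (MultiGraph.withPendants_inf_withoutPendants hID k) i j hi hij hj

/-- **`C023Skip` on arbitrary markings from its injective reading** (the half `OrbitKDedup` left open). -/
theorem C023Skip_of_C023SkipInj (h : C023SkipInj) : C023Skip := by
  intro V E _ _ _ _ G k m I D hID i j hi hij hj hk
  rw [← G.orbitKAff_pendantAt m I D i j]
  exact h (G.pendantAt m) k (fun i => Sum.inr i) Sum.inr_injective _ _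
    (MultiGraph.withPendants_inf_withoutPendants hID k) i j hi hij hj hk

/-- **`C023Skip` and its injective reading are equivalent.** -/
theorem C023Skip_iff_C023SkipInj : C023Skip ↔ C023SkipInj :=
  ⟨C023SkipInj_of_C023Skip, C023Skip_of_C023SkipInj⟩

end PercRepro
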